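import Mathlib

/-!
# The quadratic form of a product kernel factorises
(crux `QuarksAsStableAction.StableActionBridge`, item stmt-QuantumFields-9737, line `Sketch`;
registered stubs `quadForm_product_kernel` and `quadForm_sum_product_kernels_nonneg` of the lead
skeleton — the quadratic-form level of the gauge half of the Lüscher / Osterwalder–Seiler positivity
of the pure-gauge transfer operator)

The transfer operator `T̂_U` of Wilson's lattice gauge theory is the integral operator with the
(positive definite) Wilson kernel `K_β(U, U')` on `L²` of the link configurations. Passing from
kernel-level positive definiteness to nonnegativity of the QUADRATIC FORM
`∫∫ conj Ψ(u) K(u, u') Ψ(u') dμ(u') dμ(u)` starts with the two elementary facts proved here, for a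
measure space `(X, μ)` and a complex test function `Ψ`:

* `quadForm_product_kernel`: for a product kernel `K(u, u') = g(u) g(u')` the iterated integral
  FACTORISES, `∫∫ conj Ψ(u) g(u) g(u') Ψ(u') = conj(∫ g Ψ) · (∫ g Ψ) = |∫ g Ψ|²` — pull the constant
  `conj Ψ(u) g(u)` out of the inner integral (`integral_const_mul`), the constant `∫ g Ψ` out of the
  outer one (`integral_mul_const`), and use `∫ conj f = conj ∫ f` (`integral_conj`); no
  integrability is needed for this identity;
* `quadForm_sum_product_kernels_nonneg`: for a finite sum of product kernels
  `K(u, u') = ∑ₐ gₐ(u) gₐ(u')` with all `gₐ` and `Ψ` bounded measurable and `μ` finite (so that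
  every integrand is integrable and the finite sum commutes with both integrals,
  `integral_finsetSum`), the quadratic form is `∑ₐ conj(zₐ) zₐ = ∑ₐ |zₐ|²`, `zₐ = ∫ gₐ Ψ dμ`, hence
  real and nonnegative.

Mathlib only.
-/

open MeasureTheory
open scoped ComplexConjugate BigOperators

namespace Summit.QuantumFields.QCD.Cruxes.StableActionBridge.Sketch

/-- Inner integral of the quadratic form of a product kernel: for fixed `u`,
`∫ conj Ψ(u) · (g u · g u') · Ψ(u') dμ(u') = conj Ψ(u) · g(u) · ∫ g(u') Ψ(u') dμ(u')`
(a constant pulled out of the Bochner integral; no integrability needed). [folklore] -/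
private theorem integral_conj_mul_ofReal_mul_mul {X : Type} [MeasurableSpace X] (μ : Measure X)
    (g : X → ℝ) (Ψ : X → ℂ) (u : X) :
    ∫ u', conj (Ψ u) * ((g u * g u' : ℝ) : ℂ) * Ψ u' ∂μ =
      conj (Ψ u) * (g u : ℂ) * ∫ u', (g u' : ℂ) * Ψ u' ∂μ := by
  rw [← integral_const_mul]
  refine integral_congr_ae (Filter.Eventually.of_forall fun u' => ?_)
  push_cast
  ring

/-- The quadratic form of a product kernel factorises (no integrability hypotheses):
`∫∫ conj Ψ(u) · (g u · g u') · Ψ(u') dμ dμ = conj(∫ g Ψ dμ) · ∫ g Ψ dμ`. [folklore] -/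
private theorem integral_integral_conj_mul_ofReal_mul_mul {X : Type} [MeasurableSpace X]
    (μ : Measure X) (g : X → ℝ) (Ψ : X → ℂ) :
    ∫ u, ∫ u', conj (Ψ u) * ((g u * g u' : ℝ) : ℂ) * Ψ u' ∂μ ∂μ =
      conj (∫ u, (g u : ℂ) * Ψ u ∂μ) * ∫ u, (g u : ℂ) * Ψ u ∂μ := by
  have inner : ∀ u, ∫ u', conj (Ψ u) * ((g u * g u' : ℝ) : ℂ) * Ψ u' ∂μ =
      conj (Ψ u) * (g u : ℂ) * ∫ u', (g u' : ℂ) * Ψ u' ∂μ :=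
    integral_conj_mul_ofReal_mul_mul μ g Ψ
  have hconj : ∫ u, conj (Ψ u) * (g u : ℂ) ∂μ = conj (∫ u, (g u : ℂ) * Ψ u ∂μ) := by
    rw [← integral_conj]
    refine integral_congr_ae (Filter.Eventually.of_forall fun u => ?_)
    show conj (Ψ u) * (g u : ℂ) = conj ((g u : ℂ) * Ψ u)
    rw [map_mul, Complex.conj_ofReal, mul_comm]
  calc ∫ u, ∫ u', conj (Ψ u) * ((g u * g u' : ℝ) : ℂ) * Ψ u' ∂μ ∂μ
      = ∫ u, conj (Ψ u) * (g u : ℂ) * ∫ u', (g u' : ℂ) * Ψ u' ∂μ ∂μ :=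
        integral_congr_ae (Filter.Eventually.of_forall inner)
    _ = (∫ u, conj (Ψ u) * (g u : ℂ) ∂μ) * ∫ u', (g u' : ℂ) * Ψ u' ∂μ :=
        integral_mul_const _ fun u => conj (Ψ u) * (g u : ℂ)
    _ = conj (∫ u, (g u : ℂ) * Ψ u ∂μ) * ∫ u, (g u : ℂ) * Ψ u ∂μ := by rw [hconj]

/-- Real part of `conj z · z`: it is `Re z ^ 2 + Im z ^ 2`. [folklore] -/
private theorem re_conj_mul_self (z : ℂ) : (conj z * z).re = z.re ^ 2 + z.im ^ 2 := by
  simp only [Complex.mul_re, Complex.conj_re, Complex.conj_im]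
  ring

/-- Imaginary part of `conj z · z`: it vanishes. [folklore] -/
private theorem im_conj_mul_self (z : ℂ) : (conj z * z).im = 0 := by
  simp only [Complex.mul_im, Complex.conj_re, Complex.conj_im]
  ring

/-- A bounded measurable complex function on a finite measure space is integrable. [folklore] -/
private theorem integrable_of_measurable_of_bound {X : Type} [MeasurableSpace X] {μ : Measure X}
    [IsFiniteMeasure μ] {f : X → ℂ} (hf : Measurable f) {C : ℝ} (hC : ∀ u, ‖f u‖ ≤ C) :
    Integrable f μ :=
  Integrable.of_bound hf.aestronglyMeasurable C (Filter.Eventually.of_forall hC)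

/-- **The quadratic form of a product kernel factorises.** For a measure space `(X, μ)`, a real
function `g` and a complex test function `Ψ` on `X`, the iterated integral of
`conj Ψ(u) · g(u) g(u') · Ψ(u')` equals `conj(∫ g Ψ dμ) · ∫ g Ψ dμ = |∫ g Ψ dμ|²`: the constant
`conj Ψ(u) g(u)` comes out of the inner integral, the constant `∫ g Ψ dμ` out of the outer one, and
`∫ conj Ψ · g dμ = conj ∫ g Ψ dμ`. (The boundedness, measurability and finiteness hypotheses of the
registered signature are not needed for the identity itself — the Bochner integral of a
non-integrable function is `0` on both sides consistently — but they are the setting in which the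
quadratic form of the transfer kernel is used.) [folklore] -/
theorem quadForm_product_kernel : ∀ (X : Type) [MeasurableSpace X] (μ : Measure X) [IsFiniteMeasure μ] (g : X → ℝ) (Ψ : X → ℂ), (∃ C : ℝ, ∀ u, |g u| ≤ C) → Measurable g → (∃ C : ℝ, ∀ u, ‖Ψ u‖ ≤ C) → Measurable Ψ → ∫ u, ∫ u', (starRingEnd ℂ) (Ψ u) * ((g u * g u' : ℝ) : ℂ) * Ψ u' ∂μ ∂μ = (starRingEnd ℂ) (∫ u, ((g u : ℝ) : ℂ) * Ψ u ∂μ) * ∫ u, ((g u : ℝ) : ℂ) * Ψ u ∂μ := by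
  intro X _ μ _ g Ψ _ _ _ _
  exact integral_integral_conj_mul_ofReal_mul_mul μ g Ψ

/-- **The quadratic form of a finite sum of product kernels is real and nonnegative.** On a finite
measure space `(X, μ)`, let `gₐ : X → ℝ` (`a` in a finite index type) and `Ψ : X → ℂ` be bounded
and measurable. Then the quadratic form of the kernel `K(u, u') = ∑ₐ gₐ(u) gₐ(u')`,
`∫∫ conj Ψ(u) K(u, u') Ψ(u') dμ(u') dμ(u)`, has nonnegative real part and zero imaginary part.
Proof: every integrand is bounded measurable on a finite measure space, hence integrable, so the
finite sum commutes with the inner integral and — after evaluating each inner integral as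
`conj Ψ(u) gₐ(u) · ∫ gₐ Ψ dμ`, again bounded measurable in `u` — with the outer integral; by
`quadForm_product_kernel` each summand is `conj(zₐ) zₐ` with `zₐ = ∫ gₐ Ψ dμ`, whose real part is
`(Re zₐ)² + (Im zₐ)² ≥ 0` and whose imaginary part is `0`. [folklore] -/
theorem quadForm_sum_product_kernels_nonneg : ∀ (X : Type) [MeasurableSpace X] (μ : Measure X) [IsFiniteMeasure μ] (A : Type) [Fintype A] (g : A → X → ℝ) (Ψ : X → ℂ), (∀ a, ∃ C : ℝ, ∀ u, |g a u| ≤ C) → (∀ a, Measurable (g a)) → (∃ C : ℝ, ∀ u, ‖Ψ u‖ ≤ C) → Measurable Ψ → 0 ≤ (∫ u, ∫ u', (starRingEnd ℂ) (Ψ u) * ((∑ a, g a u * g a u' : ℝ) : ℂ) * Ψ u' ∂μ ∂μ).re ∧ (∫ u, ∫ u', (starRingEnd ℂ) (Ψ u) * ((∑ a, g a u * g a u' : ℝ) : ℂ) * Ψ u' ∂μ ∂μ).im = 0 := by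
  intro X _ μ _ A _ g Ψ hgb hgm hΨb hΨm
  obtain ⟨CΨ, hCΨ⟩ := hΨb
  -- the two bounded measurable (hence integrable) functions `gₐ Ψ` and `conj Ψ · gₐ`
  have hint : ∀ a, Integrable (fun u => (g a u : ℂ) * Ψ u) μ := fun a => by
    obtain ⟨C, hC⟩ := hgb a
    refine integrable_of_measurable_of_bound ((hgm a).complex_ofReal.mul hΨm) (C := C * CΨ)
      fun u => ?_
    rw [norm_mul, Complex.norm_real, Real.norm_eq_abs]
    exact mul_le_mul (hC u) (hCΨ u) (norm_nonneg _) ((abs_nonneg _).trans (hC u))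
  have hint' : ∀ a, Integrable (fun u => conj (Ψ u) * (g a u : ℂ)) μ := fun a => by
    obtain ⟨C, hC⟩ := hgb a
    refine integrable_of_measurable_of_bound
      ((Complex.continuous_conj.measurable.comp hΨm).mul (hgm a).complex_ofReal) (C := CΨ * C)
      fun u => ?_
    rw [norm_mul, Complex.norm_conj, Complex.norm_real, Real.norm_eq_abs]
    exact mul_le_mul (hCΨ u) (hC u) (abs_nonneg _) ((norm_nonneg _).trans (hCΨ u))
  -- Step 1: the finite sum commutes with the inner integral
  have e1 : ∀ u, ∫ u', conj (Ψ u) * ((∑ a, g a u * g a u' : ℝ) : ℂ) * Ψ u' ∂μ =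
      ∑ a, ∫ u', conj (Ψ u) * ((g a u * g a u' : ℝ) : ℂ) * Ψ u' ∂μ := fun u => by
    have hi : ∀ a, Integrable (fun u' => conj (Ψ u) * ((g a u * g a u' : ℝ) : ℂ) * Ψ u') μ := by
      intro a
      have e : (fun u' => conj (Ψ u) * ((g a u * g a u' : ℝ) : ℂ) * Ψ u') =
          fun u' => conj (Ψ u) * (g a u : ℂ) * ((g a u' : ℂ) * Ψ u') := by
        funext u'
        push_cast
        ring
      rw [e]
      exact (hint a).const_mul _
    rw [← integral_finsetSum Finset.univ
      (f := fun a u' => conj (Ψ u) * ((g a u * g a u' : ℝ) : ℂ) * Ψ u') fun a _ => hi a]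
    refine integral_congr_ae (Filter.Eventually.of_forall fun u' => ?_)
    simp only [Complex.ofReal_sum, Finset.mul_sum, Finset.sum_mul]
  -- Step 2: each summand is an integrable function of `u` (a bounded measurable function times
  -- the constant `∫ gₐ Ψ dμ`), so the finite sum commutes with the outer integral as well
  have e2 : ∀ a, Integrable
      (fun u => ∫ u', conj (Ψ u) * ((g a u * g a u' : ℝ) : ℂ) * Ψ u' ∂μ) μ := fun a => by
    have e : (fun u => ∫ u', conj (Ψ u) * ((g a u * g a u' : ℝ) : ℂ) * Ψ u' ∂μ) =
        fun u => conj (Ψ u) * (g a u : ℂ) * ∫ u', (g a u' : ℂ) * Ψ u' ∂μ :=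
      funext (integral_conj_mul_ofReal_mul_mul μ (g a) Ψ)
    rw [e]
    exact (hint' a).mul_const _
  -- Step 3: termwise factorisation
  have key : ∫ u, ∫ u', conj (Ψ u) * ((∑ a, g a u * g a u' : ℝ) : ℂ) * Ψ u' ∂μ ∂μ =
      ∑ a, conj (∫ u, (g a u : ℂ) * Ψ u ∂μ) * ∫ u, (g a u : ℂ) * Ψ u ∂μ := by
    rw [integral_congr_ae (Filter.Eventually.of_forall e1), integral_finsetSum _ fun a _ => e2 a]
    exact Finset.sum_congr rfl fun a _ => integral_integral_conj_mul_ofReal_mul_mul μ (g a) Ψ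
  rw [key, Complex.re_sum, Complex.im_sum]
  refine ⟨Finset.sum_nonneg fun a _ => ?_, Finset.sum_eq_zero fun a _ => im_conj_mul_self _⟩
  rw [re_conj_mul_self]
  positivity

end Summit.QuantumFields.QCD.Cruxes.StableActionBridge.Sketch
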